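import Mathlib
import Literature.Analysis.FluidPDE.KNSSLiouvilleGalileanFrame
import Summits.NavierStokesRegularity.OSWSelfSimilar.TypeIIInnerLimitUnitStream
import HarnessLib
/-!
# EVERY velocity-sup inner limit: unit stream OR (a translate of) an (AX-L) counterexample
# (zone Z1 TEMPLATE §T1.4-I (I-4) «every velocity-sup inner limit W … is EITHER (α) OR (β)», kernel, unconditional)

HONEST FRAMING (cell ns-blowup GROUP B «PROFILE SEARCH», zone Z1; D-0035/D-0074): part XXVIII of the Z1 dictionary. The
headlines of parts XXV–XXVII CONSTRUCT one gauge N-a zoom sequence and one convergent subsequence. TEMPLATE (I-4) speaks of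
EVERY velocity-sup inner limit (and (I-6): every element of the ω-limit set). This file proves the alternative for an
ARBITRARY admissible zoom sequence — running-max gauge `λₖ‖u‖ ≤ 1` on `[0, tₖ]`, `λₖ → 0`, meridional near-max centres
`xₖ = rₖe₀ + zₖe₂` (w.l.o.g. by axisymmetry), `λₖ‖u(tₖ, xₖ)‖ → 1` — and an ARBITRARY slice-wise locally uniform limit `W'`
of the max-centred zoom `y ↦ λₖu(tₖ + λₖ²s, xₖ + λₖy)`:

* `maxZoom_eq_axisZoom_shift` — the max-centred zoom slice is the axis-centred one shifted by `dₖe₀`, `dₖ = rₖ/λₖ`;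
* `innerLimit_alternative_of_every_zoom_limit` — **(I-4) FOR EVERY INNER LIMIT**: `W'` is, on every negative slice, the
  horizontal translate `y ↦ V(s, y + d₀e₀)` (`0 ≤ d₀ < ∞`; `d₀ = 0` in Case B) of a KNSS blow-up limit `V` with the Oseen
  identity which is EITHER one unit vector `c` with `c₁ = 0` (then `W' ≡ c` on `(−∞, 0) × ℝ³` as well) OR a counterexample
  to `AxisymmetricLiouvilleBoundedSwirl` (axisymmetric slices, `|Γ_V| ≤ Mₛ`, a non-constant slice) carrying the (I-5)
  signature of part XXIV (swirl present, `r‖V_pol‖` unbounded — also in EVERY axial Galilean frame, `r‖V_pol − c e_z‖`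
  unbounded for every `c` (profile-lit g12's `IsKNSSBlowupLimit.exists_lt_cylRadius_mul_norm_poloidal_sub_smul_eZ`,
  (I-5 ii)'s frame-optimised form) —, `Γ_V ∉ L^∞_sL^q`, `Γ_V` non-decaying). In Case A the
  translate is genuine (`d₀ = lim rₖ/λₖ` along the subsequence: the axis sits at `−d₀e₀` in the max-centred frame);
  subsequential limits are covered by instantiating the data along the subsequence;
* `ringType_innerLimit_unitPoloidalStream`, `ringType_every_zoom_limit_eq_const` — **RING TYPE (`rₖ/λₖ → ∞`, the
  instrument's `d = R‖u‖/ν → ∞`) ⇒ the inner object (every limit of the max-centred zoom) is a UNIT POLOIDAL STREAM**,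
  `W ≡ c`, `‖c‖ = 1`, `c₁ = 0` — never a profile, and NO conjecture enters.

**Nothing here asserts that any zoom converges, that a singular solution exists, or that (AX-L) holds or fails.**
«violates: n/a — dictionary»; bears_on LADDER-NS N5/Z1 → N1 linear core / N0⁻ ((I-4)/(I-6)). Author: ns-blowup-profile-eng-1
g8, 2026-08-27.
-/

open Real Filter Topology Set MeasureTheory Function Bornology
open scoped ENNReal NNReal
open Literature.Analysis.FluidPDE

namespace Summit.NavierStokesRegularity.OSWSelfSimilar
namespace TypeIIModulationDictionary

section EveryLimit

variable {T Mₛ : ℝ} {u : ℝ → EuclideanSpace ℝ (Fin 3) → EuclideanSpace ℝ (Fin 3)}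
  {p : ℝ → EuclideanSpace ℝ (Fin 3) → ℝ}

/-- **The max-centred zoom is the axis-centred zoom shifted by `dₖe₀`** (`dₖ = rₖ/λₖ`, `λₖ ≠ 0`):
`λu(t, rₖe₀ + zₖe₂ + λy) = λu(t, zₖe₂ + λ(y + (rₖ/λ)e₀))`. [new here — elementary] -/
theorem maxZoom_eq_axisZoom_shift {lam r z t : ℝ} (hlam : lam ≠ 0) (s : ℝ) (y : EuclideanSpace ℝ (Fin 3)) :
    (lam • stPull (lam ^ 2) lam t (EuclideanSpace.single 0 r + EuclideanSpace.single 2 z) u) s y =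
      (lam • stPull (lam ^ 2) lam t (EuclideanSpace.single 2 z) u) s
        (y + (r / lam) • EuclideanSpace.single 0 (1 : ℝ)) := by
  simp only [Pi.smul_apply, stPull_apply]
  congr 2
  ext i
  fin_cases i
  · simp; field_simp
    ring
  · simp
  · simp

/-- **TEMPLATE (I-4) FOR EVERY VELOCITY-SUP INNER LIMIT (unconditional).** Let `u` be classical (`ν = 1`, unforced) on
`[0, T⋆) × ℝ³` with axisymmetric slices, bounded with bounded energy on closed sub-slabs, `|Γ(0, ·)| ≤ Mₛ`; let
`tₖ ∈ [t₁, T⋆)` (`t₁ > 0`), `λₖ > 0`, `λₖ → 0`, `rₖ ≥ 0`, `zₖ` be ANY gauge N-a zoom data (`λₖ‖u‖ ≤ 1` on `[0, tₖ]`,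
`λₖ‖u(tₖ, rₖe₀ + zₖe₂)‖ → 1`), and let `W'` be ANY slice-wise locally uniform limit of the max-centred zoom
`y ↦ λₖu(tₖ + λₖ²s, rₖe₀ + zₖe₂ + λₖy)`. Then there are `d₀ ≥ 0` and a KNSS blow-up limit `V` with the Oseen identity such
that `W'(s, y) = V(s, y + d₀e₀)` for all `s < 0`, `y`, and EITHER (α) `V ≡ c` (hence `W' ≡ c` on `(−∞,0) × ℝ³`) for ONE
vector `c`, `‖c‖ = 1`, `c₁ = 0`, OR (β) `AxisymmetricLiouvilleBoundedSwirl` FAILS, witnessed by `V` (axisymmetric slices,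
`|Γ_V| ≤ Mₛ`, a non-constant slice), with swirl present, `r‖V_pol‖` unbounded, `r‖V_pol − c e_z‖` unbounded for every
real `c` ((I-5 ii) frame-optimised, via `IsKNSSBlowupLimit.exists_lt_cylRadius_mul_norm_poloidal_sub_smul_eZ`),
`Γ_V ∉ L^∞_sL^q` (`1 ≤ q < ∞`), `Γ_V` non-decaying. (Case B `rₖ/λₖ` unbounded along a subsequence: `d₀ = 0`, `V = W'` on negative slices, part XXI + XXVI;
Case A: `d₀ = lim rₖ/λₖ` along a subsequence and `V` = the axis-centred inner object of part XXV, identified with the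
translate of `W'` by uniqueness of limits.) [new here — dictionary; unconditional] -/
theorem innerLimit_alternative_of_every_zoom_limit (hT : 0 < T) (hu : IsClassicalNSSolutionOn (Ico 0 T) 1 0 u p)
    (haxi : ∀ t, IsAxisymmetric (u t))
    (hE : ∀ S < T, ∃ C : ℝ≥0∞, C < ⊤ ∧ ∀ t ∈ Icc 0 S, ∫⁻ x, ‖u t x‖ₑ ^ 2 ≤ C)
    (hbdd : ∀ S < T, ∃ N : ℝ, 0 < N ∧ ∀ t ∈ Icc 0 S, ∀ x, ‖u t x‖ ≤ N) (hMₛ : ∀ x, |swirl (u 0) x| ≤ Mₛ)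
    {tn lamn rn zn : ℕ → ℝ} {t₁ : ℝ} (ht₁ : 0 < t₁) (htn : ∀ k, t₁ ≤ tn k ∧ tn k < T)
    (hlam : ∀ k, 0 < lamn k) (hlam0 : Tendsto lamn atTop (𝓝 0)) (hrn : ∀ k, 0 ≤ rn k)
    (hgauge : ∀ k, ∀ t ∈ Icc 0 (tn k), ∀ x, lamn k * ‖u t x‖ ≤ 1)
    (hnear : Tendsto (fun k => lamn k *
      ‖u (tn k) (EuclideanSpace.single 0 (rn k) + EuclideanSpace.single 2 (zn k))‖) atTop (𝓝 1))
    {W' : ℝ → EuclideanSpace ℝ (Fin 3) → EuclideanSpace ℝ (Fin 3)}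
    (hconvW' : ∀ s < 0, TendstoLocallyUniformly
      (fun k => (lamn k • stPull (lamn k ^ 2) (lamn k) (tn k)
        (EuclideanSpace.single 0 (rn k) + EuclideanSpace.single 2 (zn k)) u) s) (W' s) atTop) :
    ∃ (d₀ : ℝ) (V : ℝ → EuclideanSpace ℝ (Fin 3) → EuclideanSpace ℝ (Fin 3)), 0 ≤ d₀ ∧ IsKNSSBlowupLimit V ∧
      (∀ s t : ℝ, s < t → t < 0 → ∀ x,
        V t x = Literature.Analysis.UnboundedOperators.heatExtension (V s) (t - s) x - oseenDuhamel 1 s V V t x) ∧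
      (∀ s < 0, ∀ y : EuclideanSpace ℝ (Fin 3), W' s y = V s (y + d₀ • EuclideanSpace.single 0 (1 : ℝ))) ∧
      ((∃ c : EuclideanSpace ℝ (Fin 3), ‖c‖ = 1 ∧ c 1 = 0 ∧ (∀ s < 0, ∀ y : EuclideanSpace ℝ (Fin 3), V s y = c) ∧
          ∀ s < 0, ∀ y : EuclideanSpace ℝ (Fin 3), W' s y = c) ∨
        (¬ Summit.NavierStokesRegularity.NavierStokesRegularity.AxisymmetricLiouvilleBoundedSwirl ∧
          (∀ s < 0, IsAxisymmetric (V s)) ∧ (∀ s < 0, ∀ y : EuclideanSpace ℝ (Fin 3), |swirl (V s) y| ≤ Mₛ) ∧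
          (∃ s < 0, ∃ x : EuclideanSpace ℝ (Fin 3), V s x ≠ V s 0) ∧
          (∃ s < 0, ∃ x : EuclideanSpace ℝ (Fin 3), swirl (V s) x ≠ 0) ∧
          (∀ C : ℝ, ∃ s < 0, ∃ x : EuclideanSpace ℝ (Fin 3), C < cylRadius x * ‖poloidalPart (V s) x‖) ∧
          (∀ c C : ℝ, ∃ s < 0, ∃ x : EuclideanSpace ℝ (Fin 3), C < cylRadius x * ‖poloidalPart (V s) x - c • eZ‖) ∧
          (∀ q : ℝ≥0∞, 1 ≤ q → q < ⊤ → ∀ K : ℝ≥0, ∃ s < 0, (K : ℝ≥0∞) < eLpNorm (swirl (V s)) q volume) ∧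
          ∃ ε : ℝ, 0 < ε ∧ ∀ R : ℝ, ∃ s < 0, ∃ x : EuclideanSpace ℝ (Fin 3),
            R ≤ cylRadius x ∧ ε < |swirl (V s) x|)) := by
  -- pointwise form of the given convergence, along any subsequence
  have hptW' : ∀ {ψ : ℕ → ℕ}, StrictMono ψ → ∀ s < 0, ∀ y : EuclideanSpace ℝ (Fin 3),
      Tendsto (fun k => (lamn (ψ k) • stPull (lamn (ψ k) ^ 2) (lamn (ψ k)) (tn (ψ k))
        (EuclideanSpace.single 0 (rn (ψ k)) + EuclideanSpace.single 2 (zn (ψ k))) u) s y) atTop (𝓝 (W' s y)) :=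
    fun hψ s hs y => (((hconvW' s hs).tendstoLocallyUniformlyOn (s := univ)).tendsto_at (mem_univ y)).comp
      hψ.tendsto_atTop
  by_cases hbA : BddAbove (Set.range fun k => rn k / lamn k)
  · -- ### Case A along a subsequence: `rₖ/λₖ → d₀`
    obtain ⟨C, hC⟩ := hbA
    obtain ⟨d₀, -, ψ, hψ, hd⟩ := tendsto_subseq_of_bounded (Metric.isBounded_Icc (0 : ℝ) C)
      (x := fun k => rn k / lamn k) fun k => ⟨div_nonneg (hrn k) (hlam k).le, hC ⟨k, rfl⟩⟩
    have hd₀ : 0 ≤ d₀ := ge_of_tendsto' hd fun k => div_nonneg (hrn (ψ k)) (hlam (ψ k)).le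
    obtain ⟨φ, V, hφ, hV, hconv, hax, hsw⟩ :=
      innerLimit_caseA_data_standing hT hu haxi hE hbdd hMₛ
        (tn := tn ∘ ψ) (lamn := lamn ∘ ψ) (rn := rn ∘ ψ) (zn := zn ∘ ψ) ht₁ (fun k => htn (ψ k))
        (fun k => hlam (ψ k)) (hlam0.comp hψ.tendsto_atTop) (fun k => hgauge (ψ k))
        (hnear.comp hψ.tendsto_atTop) hd
    have hmild := zoom_limit_oseenIdentity hu hE hbdd (tn := tn ∘ ψ) (lamn := lamn ∘ ψ)
      (xn := fun k => EuclideanSpace.single 2 (zn (ψ k))) ht₁ (fun k => htn (ψ k)) (fun k => hlam (ψ k))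
      (hlam0.comp hψ.tendsto_atTop) (fun k => hgauge (ψ k)) hφ hV.smooth.continuousOn hconv
    -- identification: `W'(s, y) = V(s, y + d₀ e₀)`
    have hrel : ∀ s < 0, ∀ y : EuclideanSpace ℝ (Fin 3), W' s y = V s (y + d₀ • EuclideanSpace.single 0 (1 : ℝ)) := by
      intro s hs y
      have hVc : Continuous (V s) := continuous_slice_of_continuousOn_Iio hV.smooth.continuousOn hs
      -- the shifted points converge
      have hyk : Tendsto (fun k => y + (rn (ψ (φ k)) / lamn (ψ (φ k))) • EuclideanSpace.single 0 (1 : ℝ)) atTop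
          (𝓝 (y + d₀ • EuclideanSpace.single 0 (1 : ℝ))) :=
        tendsto_const_nhds.add ((hd.comp hφ.tendsto_atTop).smul_const _)
      -- the axis-centred zoom at the shifted points tends to `V s (y + d₀ e₀)` …
      have h1 := (hconv s hs).tendsto_comp hVc.continuousAt hyk
      -- … and equals the max-centred zoom at `y`, which tends to `W' s y`
      have h2 := hptW' (hψ.comp hφ) s hs y
      refine tendsto_nhds_unique h2 (h1.congr fun k => ?_)
      exact (maxZoom_eq_axisZoom_shift (u := u) (hlam (ψ (φ k))).ne' s y).symm
    refine ⟨d₀, V, hd₀, hV, hmild, hrel, ?_⟩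
    by_cases hnc : ∃ s < 0, ∃ x : EuclideanSpace ℝ (Fin 3), V s x ≠ V s 0
    · have hsw' : ∃ C : ℝ, ∀ s < 0, ∀ x, |swirl (V s) x| ≤ C := ⟨Mₛ, hsw⟩
      have hnc' : ∃ s < 0, ∃ x y : EuclideanSpace ℝ (Fin 3), V s x ≠ V s y := by
        obtain ⟨s, hs, x, hx⟩ := hnc
        exact ⟨s, hs, x, 0, hx⟩
      exact Or.inr ⟨not_axisymmetricLiouville_of_innerLimit_typeBeta hV hax hsw' hnc, hax, hsw, hnc,
        typeBeta_exists_swirl_ne_zero hV hax hnc, knssBlowupLimit_VCR_poloidal hV hax hsw',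
        fun c C => hV.exists_lt_cylRadius_mul_norm_poloidal_sub_smul_eZ hax hsw' hnc' c C,
        fun q hq1 hq K => typeBeta_eLpNorm_swirl_unbounded hV hax hnc hq1 hq K,
        typeBeta_swirl_not_decay hV hax hnc⟩
    · push Not at hnc
      obtain ⟨β, hβ, hVβ⟩ := innerLimit_axialUnitStream_of_const hV hmild hax hnc
      refine Or.inl ⟨β • eZ, ?_, by simp [eZ], hVβ, fun s hs y => by rw [hrel s hs y, hVβ s hs]⟩
      rw [norm_smul, Real.norm_eq_abs, hβ]
      simp [eZ]
  · -- ### Case B along a subsequence: `rₖ/λₖ → ∞`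
    obtain ⟨ψ, hψ, hd⟩ := exists_subseq_tendsto_atTop_of_not_bddAbove hbA
    obtain ⟨φ, V, hφ, hV, hconv, hconst⟩ :=
      innerLimit_const_caseB_standing hu haxi hE hbdd (tn := tn ∘ ψ) (lamn := lamn ∘ ψ) (rn := rn ∘ ψ)
        (zn := zn ∘ ψ) ht₁ (fun k => htn (ψ k)) (fun k => hlam (ψ k)) (hlam0.comp hψ.tendsto_atTop)
        (fun k => hgauge (ψ k)) (hnear.comp hψ.tendsto_atTop) hd
    have hmild := zoom_limit_oseenIdentity hu hE hbdd (tn := tn ∘ ψ) (lamn := lamn ∘ ψ)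
      (xn := fun k => EuclideanSpace.single 0 (rn (ψ k)) + EuclideanSpace.single 2 (zn (ψ k))) ht₁
      (fun k => htn (ψ k)) (fun k => hlam (ψ k)) (hlam0.comp hψ.tendsto_atTop) (fun k => hgauge (ψ k)) hφ
      hV.smooth.continuousOn hconv
    have h1 := caseB_limit_apply_one_eq_zero hT hu haxi hbdd hMₛ (tn := tn ∘ ψ) (lamn := lamn ∘ ψ)
      (rn := rn ∘ ψ) (zn := zn ∘ ψ) ht₁ (fun k => htn (ψ k)) (fun k => hlam (ψ k))
      (hlam0.comp hψ.tendsto_atTop) (hnear.comp hψ.tendsto_atTop) hd hφ hconv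
    obtain ⟨c, hc1, hc⟩ := innerLimit_unitStream_of_const hV hmild hconst
    -- identification: `W'(s, ·) = V(s, ·)` (the same zoom along a subsequence)
    have hrel : ∀ s < 0, ∀ y : EuclideanSpace ℝ (Fin 3), W' s y = V s y := fun s hs y =>
      tendsto_nhds_unique (hptW' (hψ.comp hφ) s hs y)
        (((hconv s hs).tendstoLocallyUniformlyOn (s := univ)).tendsto_at (mem_univ y))
    refine ⟨0, V, le_rfl, hV, hmild, fun s hs y => by rw [zero_smul, add_zero, hrel s hs y], Or.inl ⟨c, hc1, ?_, hc,
      fun s hs y => by rw [hrel s hs y, hc s hs y]⟩⟩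
    rw [← hc (-1) (by norm_num) 0]
    exact h1 (-1) (by norm_num)

/-- **RING-TYPE scenario ⇒ UNIT POLOIDAL STREAM, NO CONJECTURE.** Let `u` be classical (`ν = 1`, unforced) on
`[0, T⋆) × ℝ³` with axisymmetric slices, bounded with bounded energy on closed sub-slabs, `|Γ(0, ·)| ≤ Mₛ`, and let
`tₖ, λₖ, rₖe₀ + zₖe₂` be ANY admissible gauge N-a zoom data of RING TYPE: `rₖ/λₖ → ∞` (the velocity maximum stays
`≫ λₖ` away from the axis — Case B of (I-3); the zone's instrument column `d = R‖u‖/ν` of CENSUS-Z1 §3 is this ratio).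
Then a subsequence of the max-centred zoom converges slice-wise locally uniformly to a KNSS blow-up limit `W` with the
Oseen identity which is ONE unit vector with no azimuthal component: `W ≡ c`, `‖c‖ = 1`, `c₁ = 0` — never a profile,
and no Liouville conjecture enters (parts XXI + XXVI). [new here — dictionary; unconditional] -/
theorem ringType_innerLimit_unitPoloidalStream (hT : 0 < T) (hu : IsClassicalNSSolutionOn (Ico 0 T) 1 0 u p)
    (haxi : ∀ t, IsAxisymmetric (u t))
    (hE : ∀ S < T, ∃ C : ℝ≥0∞, C < ⊤ ∧ ∀ t ∈ Icc 0 S, ∫⁻ x, ‖u t x‖ₑ ^ 2 ≤ C)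
    (hbdd : ∀ S < T, ∃ N : ℝ, 0 < N ∧ ∀ t ∈ Icc 0 S, ∀ x, ‖u t x‖ ≤ N) (hMₛ : ∀ x, |swirl (u 0) x| ≤ Mₛ)
    {tn lamn rn zn : ℕ → ℝ} {t₁ : ℝ} (ht₁ : 0 < t₁) (htn : ∀ k, t₁ ≤ tn k ∧ tn k < T)
    (hlam : ∀ k, 0 < lamn k) (hlam0 : Tendsto lamn atTop (𝓝 0))
    (hgauge : ∀ k, ∀ t ∈ Icc 0 (tn k), ∀ x, lamn k * ‖u t x‖ ≤ 1)
    (hnear : Tendsto (fun k => lamn k *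
      ‖u (tn k) (EuclideanSpace.single 0 (rn k) + EuclideanSpace.single 2 (zn k))‖) atTop (𝓝 1))
    (hring : Tendsto (fun k => rn k / lamn k) atTop atTop) :
    ∃ (φ : ℕ → ℕ) (W : ℝ → EuclideanSpace ℝ (Fin 3) → EuclideanSpace ℝ (Fin 3)), StrictMono φ ∧
      IsKNSSBlowupLimit W ∧
      (∀ s < 0, TendstoLocallyUniformly
        (fun k => (lamn (φ k) • stPull (lamn (φ k) ^ 2) (lamn (φ k)) (tn (φ k))
          (EuclideanSpace.single 0 (rn (φ k)) + EuclideanSpace.single 2 (zn (φ k))) u) s) (W s) atTop) ∧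
      (∀ s t : ℝ, s < t → t < 0 → ∀ x,
        W t x = Literature.Analysis.UnboundedOperators.heatExtension (W s) (t - s) x - oseenDuhamel 1 s W W t x) ∧
      ∃ c : EuclideanSpace ℝ (Fin 3), ‖c‖ = 1 ∧ c 1 = 0 ∧ ∀ s < 0, ∀ y : EuclideanSpace ℝ (Fin 3), W s y = c := by
  obtain ⟨φ, W, hφ, hW, hconv, hconst⟩ :=
    innerLimit_const_caseB_standing hu haxi hE hbdd ht₁ htn hlam hlam0 hgauge hnear hring
  have hmild := zoom_limit_oseenIdentity hu hE hbdd
    (xn := fun k => EuclideanSpace.single 0 (rn k) + EuclideanSpace.single 2 (zn k)) ht₁ htn hlam hlam0 hgauge hφ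
    hW.smooth.continuousOn hconv
  have h1 := caseB_limit_apply_one_eq_zero hT hu haxi hbdd hMₛ ht₁ htn hlam hlam0 hnear hring hφ hconv
  obtain ⟨c, hc1, hc⟩ := innerLimit_unitStream_of_const hW hmild hconst
  refine ⟨φ, W, hφ, hW, hconv, hmild, c, hc1, ?_, hc⟩
  rw [← hc (-1) (by norm_num) 0]
  exact h1 (-1) (by norm_num)

/-- **RING TYPE, EVERY LIMIT**: under the hypotheses of `ringType_innerLimit_unitPoloidalStream`, EVERY slice-wise locally
uniform limit `W'` of the max-centred zoom is one unit vector with no azimuthal component on `(−∞, 0) × ℝ³`: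
`W' ≡ c`, `‖c‖ = 1`, `c₁ = 0`. [new here — dictionary; unconditional] -/
theorem ringType_every_zoom_limit_eq_const (hT : 0 < T) (hu : IsClassicalNSSolutionOn (Ico 0 T) 1 0 u p)
    (haxi : ∀ t, IsAxisymmetric (u t))
    (hE : ∀ S < T, ∃ C : ℝ≥0∞, C < ⊤ ∧ ∀ t ∈ Icc 0 S, ∫⁻ x, ‖u t x‖ₑ ^ 2 ≤ C)
    (hbdd : ∀ S < T, ∃ N : ℝ, 0 < N ∧ ∀ t ∈ Icc 0 S, ∀ x, ‖u t x‖ ≤ N) (hMₛ : ∀ x, |swirl (u 0) x| ≤ Mₛ)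
    {tn lamn rn zn : ℕ → ℝ} {t₁ : ℝ} (ht₁ : 0 < t₁) (htn : ∀ k, t₁ ≤ tn k ∧ tn k < T)
    (hlam : ∀ k, 0 < lamn k) (hlam0 : Tendsto lamn atTop (𝓝 0))
    (hgauge : ∀ k, ∀ t ∈ Icc 0 (tn k), ∀ x, lamn k * ‖u t x‖ ≤ 1)
    (hnear : Tendsto (fun k => lamn k *
      ‖u (tn k) (EuclideanSpace.single 0 (rn k) + EuclideanSpace.single 2 (zn k))‖) atTop (𝓝 1))
    (hring : Tendsto (fun k => rn k / lamn k) atTop atTop)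
    {W' : ℝ → EuclideanSpace ℝ (Fin 3) → EuclideanSpace ℝ (Fin 3)}
    (hconvW' : ∀ s < 0, TendstoLocallyUniformly
      (fun k => (lamn k • stPull (lamn k ^ 2) (lamn k) (tn k)
        (EuclideanSpace.single 0 (rn k) + EuclideanSpace.single 2 (zn k)) u) s) (W' s) atTop) :
    ∃ c : EuclideanSpace ℝ (Fin 3), ‖c‖ = 1 ∧ c 1 = 0 ∧ ∀ s < 0, ∀ y : EuclideanSpace ℝ (Fin 3), W' s y = c := by
  obtain ⟨φ, W, hφ, -, hconv, -, c, hc1, hc0, hc⟩ :=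
    ringType_innerLimit_unitPoloidalStream hT hu haxi hE hbdd hMₛ ht₁ htn hlam hlam0 hgauge hnear hring
  refine ⟨c, hc1, hc0, fun s hs y => ?_⟩
  have h1 := (((hconvW' s hs).tendstoLocallyUniformlyOn (s := univ)).tendsto_at (mem_univ y)).comp hφ.tendsto_atTop
  have h2 := ((hconv s hs).tendstoLocallyUniformlyOn (s := univ)).tendsto_at (mem_univ y)
  rw [← hc s hs y]
  exact tendsto_nhds_unique h1 h2

end EveryLimit

end TypeIIModulationDictionary
end Summit.NavierStokesRegularity.OSWSelfSimilar
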